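import Mathlib
import Literature.Analysis.FluidPDE.ClassicalSolution
import Literature.Analysis.FluidPDE.VectorCalculus
import Literature.Analysis.FluidPDE.Vorticity
import Literature.Analysis.FluidPDE.NSVorticityProofs
import Summits.NavierStokesRegularity.NavierStokesRegularity.Theorems.SlicedKelvinDefs
import Summits.NavierStokesRegularity.NavierStokesRegularity.Theorems.SlicedKelvinPlanarFluxAPrioriPlaneCalculus
import Summits.NavierStokesRegularity.NavierStokesRegularity.Theorems.SlicedKelvinPlanarFluxAPrioriFoldLawDecay

/-!
# Crux `SlicedKelvin.PlanarFluxAPriori` (stmt-NavierStokesRegularity-15600), line `registered`: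
  space–time regularity of the fold-law integrands and the vorticity equation on the planes
  (helper for `stub_foldLawPackage`)

Along a classical Navier–Stokes solution `u` on `[0, T)` (`IsClassicalNSSolutionOn (Ico 0 T) ν 0 u p`)
the integrands of the ε-fold-law subsolution package `Theorems.SlicedKelvin.FoldLawSubsolution` —
`F_ε(f) − ε`, `D(F_ε∘f)[n]`, `D(D(F_ε∘f)[n])[n]`, `F_ε'(f)⟪w, n⟫` with `f = ⟪curl u(τ), n⟫`,
`F_ε(s) = √(s² + ε²)` and the vorticity tendency `w = νΔω − (u·∇)ω + (ω·∇)u` — are JOINTLY smooth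
fields on `[0,T) × ℝ³` (`isSmoothSpaceTimeOn_*`, from the tree's dictionary
`IsSmoothSpaceTimeOn.fderiv_slice`, `.laplacian`, `.convect`), and at interior times the regularised flux
density has the time derivative `∂_τ (F_ε(f) − ε) = F_ε'(f)⟪w, n⟫`
(`hasDerivAt_sqrtReg_sub_time`, registered sub-goal: the PROVED vorticity equation
`IsClassicalNSSolutionOn.isVorticitySolutionOn_of_convex` at `τ ∈ (0, T)`, where the one-sided time
derivative within `[0, T)` is the two-sided one).

The file also proves continuity in `x` of the fold-law integrands of a smooth field (for measurability on
the planes: `continuous_foldDensity`, …), records the ε-fold law `Theorems.SlicedKelvin.EpsFoldLawOn` in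
unfolded form (`epsFoldLawOn_explicit`, definitional), the plane integral of the fold-creation density
`∫ s_ε = −(transport) − ε²(stretching)` (`integral_foldDensity_plane`), and the elementary inequality
that assembles the subsolution inequality `φₜ − νφ₂ ≤ S` (`foldLaw_ineq`).
-/

noncomputable section

-- Problem = summit for this single-conjunct summit: the duplicate namespace component is deliberate.
set_option linter.dupNamespace false

namespace Summit.NavierStokesRegularity.NavierStokesRegularity.Theorems.SlicedKelvinPlanarFluxAPriori

open MeasureTheory Set Filter Topology
open scoped RealInnerProductSpace Laplacian ContDiff
open Literature.Analysis.FluidPDE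
open Summit.NavierStokesRegularity.NavierStokesRegularity.Theorems.SlicedKelvin

/-! ### Continuity of the fold-law integrands of a smooth field -/

section Continuity

variable {v : EuclideanSpace ℝ (Fin 3) → EuclideanSpace ℝ (Fin 3)} {ε : ℝ}

/-- The regularised flux density `F_ε(f) − ε` is continuous. -/
theorem continuous_sqrtReg_sub (hv : ContDiff ℝ ∞ v) (n : EuclideanSpace ℝ (Fin 3)) (ε : ℝ) :
    Continuous fun x => Real.sqrt (⟪curl v x, n⟫ ^ 2 + ε ^ 2) - ε :=
  ((((contDiff_inner_curl hv n).continuous.pow 2).add continuous_const).sqrt).sub continuous_const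

/-- Continuity of the building blocks `ω`, `Df`, `F_ε(f)` of the fold-law integrands. -/
theorem continuous_blocks (hv : ContDiff ℝ ∞ v) (hε : 0 < ε) (n : EuclideanSpace ℝ (Fin 3)) :
    Continuous (curl v) ∧ Continuous (fderiv ℝ (fun x => ⟪curl v x, n⟫)) ∧
      Continuous (fun x => Real.sqrt (⟪curl v x, n⟫ ^ 2 + ε ^ 2)) ∧
      (∀ x, Real.sqrt (⟪curl v x, n⟫ ^ 2 + ε ^ 2) ≠ 0) ∧
      Continuous (fun x => ε ^ 2 / Real.sqrt (⟪curl v x, n⟫ ^ 2 + ε ^ 2) ^ 3) ∧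
      Continuous (fderiv ℝ (fun z => ⟪v z, n⟫)) := by
  have hω : Continuous (curl v) := (contDiff_curl hv).continuous
  have hDf : Continuous (fderiv ℝ (fun x => ⟪curl v x, n⟫)) :=
    (contDiff_inner_curl hv n).continuous_fderiv (by simp)
  have hF : Continuous fun x => Real.sqrt (⟪curl v x, n⟫ ^ 2 + ε ^ 2) :=
    (((hω.inner continuous_const).pow 2).add continuous_const).sqrt
  have hF0 : ∀ x, Real.sqrt (⟪curl v x, n⟫ ^ 2 + ε ^ 2) ≠ 0 := fun x => (sqrt_sq_add_sq_pos hε _).ne'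
  have hq : Continuous fun x => ε ^ 2 / Real.sqrt (⟪curl v x, n⟫ ^ 2 + ε ^ 2) ^ 3 :=
    continuous_const.div (hF.pow 3) fun x => pow_ne_zero 3 (hF0 x)
  have hDvn : Continuous (fderiv ℝ (fun z => ⟪v z, n⟫)) :=
    (hv.inner ℝ contDiff_const).continuous_fderiv (by simp)
  exact ⟨hω, hDf, hF, hF0, hq, hDvn⟩

/-- The transport density is continuous. -/
theorem continuous_transportDensity (hv : ContDiff ℝ ∞ v) (hε : 0 < ε)
    (n e₀ e₁ : EuclideanSpace ℝ (Fin 3)) :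
    Continuous fun x => ⟪v x, n⟫ * (ε ^ 2 / Real.sqrt (⟪curl v x, n⟫ ^ 2 + ε ^ 2) ^ 3) *
      (⟪curl v x, e₀⟫ * fderiv ℝ (fun x => ⟪curl v x, n⟫) x e₀ +
        ⟪curl v x, e₁⟫ * fderiv ℝ (fun x => ⟪curl v x, n⟫) x e₁) := by
  obtain ⟨hω, hDf, hF, hF0, hq, hDvn⟩ := continuous_blocks hv hε n
  exact ((hv.continuous.inner continuous_const).mul hq).mul
    (((hω.inner continuous_const).mul (hDf.clm_apply continuous_const)).add
      ((hω.inner continuous_const).mul (hDf.clm_apply continuous_const)))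

/-- The stretching density is continuous. -/
theorem continuous_stretchDensity (hv : ContDiff ℝ ∞ v) (hε : 0 < ε) (n : EuclideanSpace ℝ (Fin 3)) :
    Continuous fun x => fderiv ℝ (fun z => ⟪v z, n⟫) x n / Real.sqrt (⟪curl v x, n⟫ ^ 2 + ε ^ 2) := by
  obtain ⟨hω, hDf, hF, hF0, hq, hDvn⟩ := continuous_blocks hv hε n
  exact (hDvn.clm_apply continuous_const).div hF hF0

/-- The annihilation density is continuous. -/
theorem continuous_annihilationDensity (hv : ContDiff ℝ ∞ v) (hε : 0 < ε)
    (n e₀ e₁ : EuclideanSpace ℝ (Fin 3)) :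
    Continuous fun x => ε ^ 2 / Real.sqrt (⟪curl v x, n⟫ ^ 2 + ε ^ 2) ^ 3 *
      (fderiv ℝ (fun x => ⟪curl v x, n⟫) x e₀ ^ 2 + fderiv ℝ (fun x => ⟪curl v x, n⟫) x e₁ ^ 2 +
        fderiv ℝ (fun x => ⟪curl v x, n⟫) x n ^ 2) := by
  obtain ⟨hω, hDf, hF, hF0, hq, hDvn⟩ := continuous_blocks hv hε n
  exact hq.mul ((((hDf.clm_apply continuous_const).pow 2).add
    ((hDf.clm_apply continuous_const).pow 2)).add ((hDf.clm_apply continuous_const).pow 2))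

/-- The ε-regularised fold-creation density of a smooth field is continuous (`ε > 0`). -/
theorem continuous_foldDensity (hv : ContDiff ℝ ∞ v) (hε : 0 < ε)
    (R : EuclideanSpace ℝ (Fin 3) ≃ₗᵢ[ℝ] EuclideanSpace ℝ (Fin 3)) :
    Continuous (foldDensity v R ε) := by
  obtain ⟨hω, hDf, hF, hF0, hq, hDvn⟩ := continuous_blocks hv hε (R (EuclideanSpace.single 2 1))
  unfold foldDensity
  exact (((hv.continuous.inner continuous_const).neg.mul hq).mul
    (((hω.inner continuous_const).mul (hDf.clm_apply continuous_const)).add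
      ((hω.inner continuous_const).mul (hDf.clm_apply continuous_const)))).sub
    ((continuous_const.mul (hDvn.clm_apply continuous_const)).div hF hF0)

end Continuity

/-! ### Joint smoothness of the fold-law integrands -/

section Joint

variable {S : Set ℝ} {u : ℝ → EuclideanSpace ℝ (Fin 3) → EuclideanSpace ℝ (Fin 3)}

/-- The vorticity `(τ, x) ↦ curl u(τ) (x)` of a jointly smooth velocity is jointly smooth
(`curl = curlCLM ∘ D`). -/
theorem isSmoothSpaceTimeOn_curl (hu : IsSmoothSpaceTimeOn S u) (hS : UniqueDiffOn ℝ S) :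
    IsSmoothSpaceTimeOn S (fun τ x => curl (u τ) x) :=
  curlCLM.contDiff.comp_contDiffOn (hu.fderiv_slice hS)

/-- The normal vorticity `f = ⟪curl u(τ), n⟫` is jointly smooth. -/
theorem isSmoothSpaceTimeOn_inner_curl (hu : IsSmoothSpaceTimeOn S u) (hS : UniqueDiffOn ℝ S)
    (n : EuclideanSpace ℝ (Fin 3)) : IsSmoothSpaceTimeOn S (fun τ x => ⟪curl (u τ) x, n⟫) :=
  (isSmoothSpaceTimeOn_curl hu hS).inner (v' := fun _ _ => n) contDiffOn_const

/-- The regularised normal vorticity `F_ε(f)` is jointly smooth (`ε > 0`). -/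
theorem isSmoothSpaceTimeOn_sqrtReg (hu : IsSmoothSpaceTimeOn S u) (hS : UniqueDiffOn ℝ S) {ε : ℝ}
    (hε : 0 < ε) (n : EuclideanSpace ℝ (Fin 3)) :
    IsSmoothSpaceTimeOn S (fun τ x => Real.sqrt (⟪curl (u τ) x, n⟫ ^ 2 + ε ^ 2)) :=
  (((isSmoothSpaceTimeOn_inner_curl hu hS n).pow 2).add contDiffOn_const).sqrt
    fun p _ => ne_of_gt (by positivity)

/-- `F_ε(f) − ε` is jointly smooth. -/
theorem isSmoothSpaceTimeOn_sqrtReg_sub (hu : IsSmoothSpaceTimeOn S u) (hS : UniqueDiffOn ℝ S) {ε : ℝ}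
    (hε : 0 < ε) (n : EuclideanSpace ℝ (Fin 3)) :
    IsSmoothSpaceTimeOn S (fun τ x => Real.sqrt (⟪curl (u τ) x, n⟫ ^ 2 + ε ^ 2) - ε) :=
  (isSmoothSpaceTimeOn_sqrtReg hu hS hε n).sub contDiffOn_const

/-- `D(F_ε∘f)[n]` is jointly smooth. -/
theorem isSmoothSpaceTimeOn_fderiv_sqrtReg_apply (hu : IsSmoothSpaceTimeOn S u) (hS : UniqueDiffOn ℝ S)
    {ε : ℝ} (hε : 0 < ε) (n : EuclideanSpace ℝ (Fin 3)) :
    IsSmoothSpaceTimeOn S (fun τ x =>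
      fderiv ℝ (fun x => Real.sqrt (⟪curl (u τ) x, n⟫ ^ 2 + ε ^ 2)) x n) :=
  ((isSmoothSpaceTimeOn_sqrtReg hu hS hε n).fderiv_slice hS).clm_apply contDiffOn_const

/-- `D(D(F_ε∘f)[n])[n]` is jointly smooth. -/
theorem isSmoothSpaceTimeOn_fderiv_fderiv_sqrtReg_apply (hu : IsSmoothSpaceTimeOn S u)
    (hS : UniqueDiffOn ℝ S) {ε : ℝ} (hε : 0 < ε) (n : EuclideanSpace ℝ (Fin 3)) :
    IsSmoothSpaceTimeOn S (fun τ x => fderiv ℝ (fun x =>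
      fderiv ℝ (fun x => Real.sqrt (⟪curl (u τ) x, n⟫ ^ 2 + ε ^ 2)) x n) x n) :=
  ((isSmoothSpaceTimeOn_fderiv_sqrtReg_apply hu hS hε n).fderiv_slice hS).clm_apply contDiffOn_const

/-- The vorticity tendency `w = νΔω − (u·∇)ω + (ω·∇)u` is jointly smooth. -/
theorem isSmoothSpaceTimeOn_tendency (hu : IsSmoothSpaceTimeOn S u) (hS : UniqueDiffOn ℝ S) (ν : ℝ) :
    IsSmoothSpaceTimeOn S (fun τ x =>
      ν • Δ (curl (u τ)) x - convect (u τ) (curl (u τ)) x + convect (curl (u τ)) (u τ) x) :=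
  have hω := isSmoothSpaceTimeOn_curl hu hS
  (((hω.laplacian hS).const_smul ν).sub (hu.convect hω hS)).add (hω.convect hu hS)

/-- The time density `F_ε'(f)⟪w, n⟫` is jointly smooth. -/
theorem isSmoothSpaceTimeOn_timeDensity (hu : IsSmoothSpaceTimeOn S u) (hS : UniqueDiffOn ℝ S)
    {ε : ℝ} (hε : 0 < ε) (n : EuclideanSpace ℝ (Fin 3)) (ν : ℝ) :
    IsSmoothSpaceTimeOn S (fun τ x =>
      ⟪curl (u τ) x, n⟫ / Real.sqrt (⟪curl (u τ) x, n⟫ ^ 2 + ε ^ 2) *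
        ⟪ν • Δ (curl (u τ)) x - convect (u τ) (curl (u τ)) x + convect (curl (u τ)) (u τ) x, n⟫) :=
  ((isSmoothSpaceTimeOn_inner_curl hu hS n).div (isSmoothSpaceTimeOn_sqrtReg hu hS hε n)
    fun _ _ => (sqrt_sq_add_sq_pos hε _).ne').mul
    ((isSmoothSpaceTimeOn_tendency hu hS ν).inner (v' := fun _ _ => n) contDiffOn_const)

/-- Slices of a jointly continuous field are continuous. -/
theorem continuous_slice_of_continuousOn {g : ℝ → EuclideanSpace ℝ (Fin 3) → ℝ}
    (hg : ContinuousOn (Function.uncurry g) (S ×ˢ univ)) {τ : ℝ} (hτ : τ ∈ S) : Continuous (g τ) :=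
  hg.comp_continuous (continuous_const.prodMk continuous_id) fun x => mk_mem_prod hτ (mem_univ x)

end Joint

/-! ### The time derivative of the regularised flux density -/

/-- **`∂_τ (F_ε(f) − ε) = F_ε'(f)⟪w, n⟫` at interior times** (registered sub-goal of
`stub_foldLawPackage`). Along a classical Navier–Stokes solution on `[0, T)`, for `τ ∈ (0, T)` the time
line `σ ↦ √(⟪curl u(σ)(x), n⟫² + ε²) − ε` has derivative `(f/F_ε(f)) ⟪νΔω − (u·∇)ω + (ω·∇)u, n⟫` at
`τ`: the vorticity equation `IsClassicalNSSolutionOn.isVorticitySolutionOn_of_convex` (the one-sided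
derivative within `[0,T)` being two-sided at interior times) and the chain rule. -/
theorem hasDerivAt_sqrtReg_sub_time : ∀ (ν T ε : ℝ) (u : ℝ → EuclideanSpace ℝ (Fin 3) → EuclideanSpace ℝ (Fin 3)) (p : ℝ → EuclideanSpace ℝ (Fin 3) → ℝ), Literature.Analysis.FluidPDE.IsClassicalNSSolutionOn (Set.Ico 0 T) ν 0 u p → 0 < ε → ∀ (n : EuclideanSpace ℝ (Fin 3)), ∀ τ ∈ Set.Ioo 0 T, ∀ (x : EuclideanSpace ℝ (Fin 3)), HasDerivAt (fun σ => Real.sqrt (inner ℝ (Literature.Analysis.FluidPDE.curl (u σ) x) n ^ 2 + ε ^ 2) - ε) (inner ℝ (Literature.Analysis.FluidPDE.curl (u τ) x) n / Real.sqrt (inner ℝ (Literature.Analysis.FluidPDE.curl (u τ) x) n ^ 2 + ε ^ 2) * inner ℝ (ν • Laplacian.laplacian (Literature.Analysis.FluidPDE.curl (u τ)) x - Literature.Analysis.FluidPDE.convect (u τ) (Literature.Analysis.FluidPDE.curl (u τ)) x + Literature.Analysis.FluidPDE.convect (Literature.Analysis.FluidPDE.curl (u τ)) (u τ) x) n) τ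 := by
  intro ν T ε u p hcl hε n τ hτ x
  have hU : UniqueDiffOn ℝ (Ico 0 T) := uniqueDiffOn_Ico 0 T
  have hτ' : τ ∈ Ico 0 T := ⟨hτ.1.le, hτ.2⟩
  have hω := isSmoothSpaceTimeOn_curl hcl.smooth_velocity hU
  -- the vorticity time line is differentiable, with derivative given by the vorticity equation
  have h1 : HasDerivAt (fun s => curl (u s) x)
      (timeDerivWithin (Ico 0 T) (fun τ x => curl (u τ) x) τ x) τ :=
    (hω.hasDerivWithinAt_timeDerivWithin hU hτ' x).hasDerivAt (Ico_mem_nhds hτ.1 hτ.2)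
  have hve := (hcl.isVorticitySolutionOn_of_convex hU (convex_Ico 0 T)).vorticity_eq τ hτ' x
  have h2 : timeDerivWithin (Ico 0 T) (fun τ x => curl (u τ) x) τ x =
      ν • Δ (curl (u τ)) x - convect (u τ) (curl (u τ)) x + convect (curl (u τ)) (u τ) x := by
    have e : timeDerivWithin (Ico 0 T) (vorticity u) τ x =
        timeDerivWithin (Ico 0 T) (fun τ x => curl (u τ) x) τ x := rfl
    rw [← e, eq_sub_of_add_eq hve]
    simp only [vorticity_apply]
    abel
  rw [h2] at h1
  -- the normal component
  have h3 : HasDerivAt (fun s => ⟪curl (u s) x, n⟫)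
      ⟪ν • Δ (curl (u τ)) x - convect (u τ) (curl (u τ)) x + convect (curl (u τ)) (u τ) x, n⟫ τ := by
    have := h1.inner ℝ (hasDerivAt_const τ n)
    simpa using this
  -- the regularisation
  have h4 := ((h3.fun_pow 2).add_const (ε ^ 2)).sqrt (ne_of_gt (by positivity))
  refine (h4.sub_const ε).congr_deriv ?_
  have hF := sqrt_sq_add_sq_pos hε ⟪curl (u τ) x, n⟫
  simp only [show (2 : ℕ) - 1 = 1 from rfl, pow_one, Nat.cast_ofNat]
  field_simp

/-! ### The ε-fold law, unfolded -/

/-- The frame-covariant ε-fold law `EpsFoldLawOn ν ε c R v` with its `let`s unfolded (definitional). -/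
theorem epsFoldLawOn_explicit {ν ε c : ℝ} {R : EuclideanSpace ℝ (Fin 3) ≃ₗᵢ[ℝ] EuclideanSpace ℝ (Fin 3)}
    {v : EuclideanSpace ℝ (Fin 3) → EuclideanSpace ℝ (Fin 3)} (h : EpsFoldLawOn ν ε c R v) :
    (∫ y : EuclideanSpace ℝ (Fin 2), inner ℝ (Literature.Analysis.FluidPDE.curl v (R (WithLp.toLp 2 ![y 0, y 1, c]))) (R (EuclideanSpace.single 2 1)) / Real.sqrt (inner ℝ (Literature.Analysis.FluidPDE.curl v (R (WithLp.toLp 2 ![y 0, y 1, c]))) (R (EuclideanSpace.single 2 1)) ^ 2 + ε ^ 2) * inner ℝ (ν • Laplacian.laplacian (Literature.Analysis.FluidPDE.curl v) (R (WithLp.toLp 2 ![y 0, y 1, c])) - Literature.Analysis.FluidPDE.convect v (Literature.Analysis.FluidPDE.curl v) (R (WithLp.toLp 2 ![y 0, y 1, c])) + Literature.Analysis.FluidPDE.convect (Literature.Analysis.FluidPDE.curl v) v (R (WithLp.toLp 2 ![y 0, y 1, c]))) (R (EuclideanSpace.single 2 1))) = ν * (∫ y : EuclideanSpace ℝ (Fin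 2), fderiv ℝ (fun x => fderiv ℝ (fun x => Real.sqrt (inner ℝ (Literature.Analysis.FluidPDE.curl v x) (R (EuclideanSpace.single 2 1)) ^ 2 + ε ^ 2)) x (R (EuclideanSpace.single 2 1))) (R (WithLp.toLp 2 ![y 0, y 1, c])) (R (EuclideanSpace.single 2 1))) - ν * (∫ y : EuclideanSpace ℝ (Fin 2), ε ^ 2 / Real.sqrt (inner ℝ (Literature.Analysis.FluidPDE.curl v (R (WithLp.toLp 2 ![y 0, y 1, c]))) (R (EuclideanSpace.single 2 1)) ^ 2 + ε ^ 2) ^ 3 * (fderiv ℝ (fun x => inner ℝ (Literature.Analysis.FluidPDE.curl v x) (R (EuclideanSpace.single 2 1))) (R (WithLp.toLp 2 ![y 0, y 1, c])) (R (EuclideanSpace.single 0 1)) ^ 2 + fderiv ℝ (fun x => inner ℝ (Literature.Analysis.FluidPDE.curl v x) (R (EuclideanSpace.single 2 1))) (R (WithLp.toLp 2 ![y 0, y 1, c])) (R (EuclideanSpace.single 1 1)) ^ 2 + fderiv ℝ (fun x => inner ℝ (Literature.Analysis.FluidPDE.curl v x) (R (EuclideanSpace.single 2 1))) (R (WithLp.toLp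 2 ![y 0, y 1, c])) (R (EuclideanSpace.single 2 1)) ^ 2)) - (∫ y : EuclideanSpace ℝ (Fin 2), inner ℝ (v (R (WithLp.toLp 2 ![y 0, y 1, c]))) (R (EuclideanSpace.single 2 1)) * (ε ^ 2 / Real.sqrt (inner ℝ (Literature.Analysis.FluidPDE.curl v (R (WithLp.toLp 2 ![y 0, y 1, c]))) (R (EuclideanSpace.single 2 1)) ^ 2 + ε ^ 2) ^ 3) * (inner ℝ (Literature.Analysis.FluidPDE.curl v (R (WithLp.toLp 2 ![y 0, y 1, c]))) (R (EuclideanSpace.single 0 1)) * fderiv ℝ (fun x => inner ℝ (Literature.Analysis.FluidPDE.curl v x) (R (EuclideanSpace.single 2 1))) (R (WithLp.toLp 2 ![y 0, y 1, c])) (R (EuclideanSpace.single 0 1)) + inner ℝ (Literature.Analysis.FluidPDE.curl v (R (WithLp.toLp 2 ![y 0, y 1, c]))) (R (EuclideanSpace.single 1 1)) * fderiv ℝ (fun x => inner ℝ (Literature.Analysis.FluidPDE.curl v x) (R (EuclideanSpace.single 2 1))) (R (WithLp.toLp 2 ![y 0, y 1, c])) (R (EuclideanSpace.single 1 1)))) -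 ε ^ 2 * (∫ y : EuclideanSpace ℝ (Fin 2), fderiv ℝ (fun z => inner ℝ (v z) (R (EuclideanSpace.single 2 1))) (R (WithLp.toLp 2 ![y 0, y 1, c])) (R (EuclideanSpace.single 2 1)) / Real.sqrt (inner ℝ (Literature.Analysis.FluidPDE.curl v (R (WithLp.toLp 2 ![y 0, y 1, c]))) (R (EuclideanSpace.single 2 1)) ^ 2 + ε ^ 2)) :=
  h

/-- **The plane integral of the fold-creation density** splits into the transport and stretching
integrals of the ε-fold law: `∫ s_ε = −∫(transport) − ε²∫(stretching)` (both integrable by decay). -/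
theorem integral_foldDensity_plane {v : EuclideanSpace ℝ (Fin 3) → EuclideanSpace ℝ (Fin 3)} {C ε : ℝ}
    (hv : ContDiff ℝ ∞ v) (hC : ∀ (x : EuclideanSpace ℝ (Fin 3)) (k : ℕ), k ≤ 3 →
      (1 + ‖x‖) ^ 3 * ‖iteratedFDeriv ℝ k v x‖ ≤ C) (hε : 0 < ε)
    (R : EuclideanSpace ℝ (Fin 3) ≃ₗᵢ[ℝ] EuclideanSpace ℝ (Fin 3)) (c : ℝ) :
    ∫ y : EuclideanSpace ℝ (Fin 2), Summit.NavierStokesRegularity.NavierStokesRegularity.Theorems.SlicedKelvin.foldDensity v R ε (R (WithLp.toLp 2 ![y 0, y 1, c])) = -(∫ y : EuclideanSpace ℝ (Fin 2), inner ℝ (v (R (WithLp.toLp 2 ![y 0, y 1, c]))) (R (EuclideanSpace.single 2 1)) * (ε ^ 2 / Real.sqrt (inner ℝ (Literature.Analysis.FluidPDE.curl v (R (WithLp.toLp 2 ![y 0, y 1, c]))) (R (EuclideanSpace.single 2 1)) ^ 2 + ε ^ 2) ^ 3) * (inner ℝ (Literature.Analysis.FluidPDE.curl v (R (WithLp.toLp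 2 ![y 0, y 1, c]))) (R (EuclideanSpace.single 0 1)) * fderiv ℝ (fun x => inner ℝ (Literature.Analysis.FluidPDE.curl v x) (R (EuclideanSpace.single 2 1))) (R (WithLp.toLp 2 ![y 0, y 1, c])) (R (EuclideanSpace.single 0 1)) + inner ℝ (Literature.Analysis.FluidPDE.curl v (R (WithLp.toLp 2 ![y 0, y 1, c]))) (R (EuclideanSpace.single 1 1)) * fderiv ℝ (fun x => inner ℝ (Literature.Analysis.FluidPDE.curl v x) (R (EuclideanSpace.single 2 1))) (R (WithLp.toLp 2 ![y 0, y 1, c])) (R (EuclideanSpace.single 1 1)))) - ε ^ 2 * (∫ y : EuclideanSpace ℝ (Fin 2), fderiv ℝ (fun z => inner ℝ (v z) (R (EuclideanSpace.single 2 1))) (R (WithLp.toLp 2 ![y 0, y 1, c])) (R (EuclideanSpace.single 2 1)) / Real.sqrt (inner ℝ (Literature.Analysis.FluidPDE.curl v (R (WithLp.toLp 2 ![y 0, y 1, c]))) (R (EuclideanSpace.single 2 1)) ^ 2 + ε ^ 2)) := by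
  have hn := norm_frame R 2
  have he₀ := norm_frame R 0
  have he₁ := norm_frame R 1
  have hi₃ := integrable_plane_of_norm_le R (continuous_transportDensity hv hε
    (R (EuclideanSpace.single 2 1)) (R (EuclideanSpace.single 0 1)) (R (EuclideanSpace.single 1 1)))
    (fun x => by
      rw [Real.norm_eq_abs]
      exact abs_transportDensity_le_decay hv hC hn hε he₀ he₁ x) c
  have hi₄ := integrable_plane_of_norm_le R (continuous_stretchDensity hv hε (R (EuclideanSpace.single 2 1)))
    (fun x => by
      rw [Real.norm_eq_abs]
      exact abs_stretchDensity_le_decay hv hC hn hε x) c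
  simp only [foldDensity, neg_mul, mul_div_assoc]
  rw [← integral_neg, ← integral_const_mul]
  exact integral_sub hi₃.neg (hi₄.const_mul _)

/-- The annihilation integral `∫ F_ε''(f)|∇f|²` over a plane is nonnegative. -/
theorem integral_annihilation_nonneg {v : EuclideanSpace ℝ (Fin 3) → EuclideanSpace ℝ (Fin 3)} {ε : ℝ}
    (R : EuclideanSpace ℝ (Fin 3) ≃ₗᵢ[ℝ] EuclideanSpace ℝ (Fin 3)) (c : ℝ) :
    0 ≤ ∫ y : EuclideanSpace ℝ (Fin 2), ε ^ 2 / Real.sqrt (inner ℝ (Literature.Analysis.FluidPDE.curl v (R (WithLp.toLp 2 ![y 0, y 1, c]))) (R (EuclideanSpace.single 2 1)) ^ 2 + ε ^ 2) ^ 3 * (fderiv ℝ (fun x => inner ℝ (Literature.Analysis.FluidPDE.curl v x) (R (EuclideanSpace.single 2 1))) (R (WithLp.toLp 2 ![y 0, y 1, c])) (R (EuclideanSpace.single 0 1)) ^ 2 + fderiv ℝ (fun x => inner ℝ (Literature.Analysis.FluidPDE.curl v x) (R (EuclideanSpace.single 2 1))) (R (WithLp.toLp 2 ![y 0, y 1,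 c])) (R (EuclideanSpace.single 1 1)) ^ 2 + fderiv ℝ (fun x => inner ℝ (Literature.Analysis.FluidPDE.curl v x) (R (EuclideanSpace.single 2 1))) (R (WithLp.toLp 2 ![y 0, y 1, c])) (R (EuclideanSpace.single 2 1)) ^ 2) :=
  integral_nonneg fun _ => annihilationDensity_nonneg _ _ _ _

/-- The arithmetic of the subsolution inequality: from the ε-fold law `A = νB − νI₂ − I₃ − ε²I₄`,
`ν ≥ 0`, `I₂ ≥ 0`, `∫ s_ε = −I₃ − ε²I₄ ≤ S` one gets `A − νB ≤ S`. -/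
theorem foldLaw_ineq {A B I₂ I₃ I₄ F Src ν ε : ℝ} (hid : A = ν * B - ν * I₂ - I₃ - ε ^ 2 * I₄)
    (hν : 0 ≤ ν) (hI₂ : 0 ≤ I₂) (hmono : F ≤ Src) (hF : F = -I₃ - ε ^ 2 * I₄) : A - ν * B ≤ Src := by
  nlinarith [mul_nonneg hν hI₂]

end Summit.NavierStokesRegularity.NavierStokesRegularity.Theorems.SlicedKelvinPlanarFluxAPriori

end
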